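import Literature.Barriers.CriticalPhenomena.PlaquetteWalkHoleRootCutMarking
import HarnessLib

/-!
# Barrier catalogue (SAWScalingLimit): THE POCKET LAW — two live cut edges on different rhombi, one of them the door of a pocket

Leaf of `PlaquetteWalkHoleRootCutMarking` (localisation on a cut with exactly two live edges, `ΩG.prefix_and_exit_of_twoLive_cut`:
the PREFIX crosses the first live edge `eᵢ`, a slot of the EXCURSION polygon exits through the second `e_k`). When the two live
edges lie on ONE rhombus the marking law applies; this file treats the other case by DOOR COUNTING, the mechanism behind the lane's
corridor / dead-end / shut-row emptinesses (`PlaquetteWalkHoleRootCorridor`, `…EastDeadEnd`, `…ShutRow*`, `…WallPocket`), once: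

§1 ★★★★★ `ΩG.AJ_root_eq_zero_of_twoLive_cut_pocket` / `ΩG.WE_eq_excursionWinding_of_under_twoLive_cut_pocket` — THE POCKET LAW.
Let `P` be any set of cells («pocket») containing a face of `eᵢ` but neither the root cell `w` nor the far cell, such that every LIVE
DOOR of `P` (a mid-edge between a cell of `P ∩ D` and a cell of `D ∖ P`) is `eᵢ` or `e_k`. Then no class-`B2a` UNDER-walk is wound:
the prefix, which starts at `w ∉ P` and reaches the far cell `∉ P`, crosses `eᵢ`, so it is inside `P` just before or just after that
crossing; leaving (or having entered) `P` costs another live door, which can only be `e_k` — but `e_k` is an excursion edge, and a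
mid-edge is used once (`prefix_nth_ne_of_exit`, `YBWalk.nth_inj_of_le`).
§2 The bookkeeping: `ΩG.fc_mem_faces_of_nth` (the cells before and after the `t`-th mid-edge are its two faces),
`ΩG.exists_door_of_exit_pocket` / `…_of_enter_pocket` (a cell path leaving / entering `P` crosses a door of `P`).

Not in print; venture lane «pcv-sawmu», seat b-step0 gen 29 (FINDING-YB-KILL-FORCED-ZEROS §28; DESIGN-next-g29 §3 (3)).

References: A. Glazman, I. Manolescu, arXiv:1708.00395v3, §1 (Fig. 1–2), §2.1, Lemma 2.1 [GlazmanManolescu2019]; A. Glazman,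
Electron. Commun. Probab. 20 (2015) no. 86, Lemma 3.1, proof pp. 6–7 [Glazman2015WeightedSAW]; R. Courant, H. Robbins, *What is
Mathematics?* (1941/1958), Ch. V Appendix §2 (the even–odd rule) [CourantRobbins1958].
-/

noncomputable section

open Set Function Complex
open Literature.Topology.PlaneTopology

namespace Literature.Probability.RandomPlanarGeometry.SAW.YangBaxter

open Real

open private fc_fh from Literature.Probability.RandomPlanarGeometry.YangBaxterSAWGeneralDomain

namespace ΩG

variable {D : Set Face} {w : Face} {ω : ΩG D (w.side .W) (farW w)}

/-! ## §2 (first) Cells along the walk and the doors of a pocket -/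

/-- **The cells before and after the `t`-th mid-edge are its two faces** (`1 ≤ t < length`): `fc (t − 1) ≠ fc t`, both have `nth t`
as a side, both lie in `D`. [cite: GlazmanManolescu2019, §1 (an arc joins two sides of one rhombus)]
[cite: Glazman2015WeightedSAW, Lemma 3.1 (proof, pp. 6–7)] -/
theorem fc_mem_faces_of_nth {t : ℕ} (ht1 : 1 ≤ t) (ht : t < ω.2.arcs.length) :
    (∃ x : Side, (ω.2.fc (t - 1)).side x = ω.2.nth t) ∧ (∃ x : Side, (ω.2.fc t).side x = ω.2.nth t) ∧
      ω.2.fc (t - 1) ≠ ω.2.fc t ∧ ω.2.fc (t - 1) ∈ D ∧ ω.2.fc t ∈ D := by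
  have ht' : t - 1 < ω.2.arcs.length := by omega
  have h1 := (YBWalk.side_sIn_eq_nth ω.2 ht').2
  rw [show t - 1 + 1 = t by omega] at h1
  have h2 := (YBWalk.side_sIn_eq_nth ω.2 ht).1
  have hne := ω.2.fc_succ_ne (i := t - 1) (by omega)
  rw [show t - 1 + 1 = t by omega] at hne
  exact ⟨⟨_, h1⟩, ⟨_, h2⟩, hne, (ω.2.arcFace_arcAt ht').2, (ω.2.arcFace_arcAt ht).2⟩

/-- **Leaving a pocket costs a door**: if `fc a ∈ P` and `fc b ∉ P` for `a < b < length`, some `t` with `a < t ≤ b` has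
`fc (t − 1) ∈ P`, `fc t ∉ P`. [cite: GlazmanManolescu2019, §1 (the lattice of rhombi and its mid-edges)] -/
theorem exists_door_of_exit_pocket {P : Set Face} {a b : ℕ} (hab : a < b) (ha : ω.2.fc a ∈ P) (hb : ω.2.fc b ∉ P) :
    ∃ t, a < t ∧ t ≤ b ∧ ω.2.fc (t - 1) ∈ P ∧ ω.2.fc t ∉ P := by
  classical
  have hex : ∃ n, a < n ∧ ω.2.fc n ∉ P := ⟨b, hab, hb⟩
  refine ⟨Nat.find hex, (Nat.find_spec hex).1, Nat.find_min' hex ⟨hab, hb⟩, ?_, (Nat.find_spec hex).2⟩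
  by_contra hn
  have hlt : a < Nat.find hex := (Nat.find_spec hex).1
  rcases eq_or_lt_of_le (show a + 1 ≤ Nat.find hex from hlt) with e | hlt'
  · rw [← e, Nat.add_sub_cancel] at hn; exact hn ha
  · exact Nat.find_min hex (show Nat.find hex - 1 < Nat.find hex by omega) ⟨by omega, hn⟩

/-- **Entering a pocket costs a door**: if `fc a ∉ P` and `fc b ∈ P` for `a < b`, some `t` with `a < t ≤ b` has `fc (t − 1) ∉ P`,
`fc t ∈ P`. [cite: GlazmanManolescu2019, §1 (the lattice of rhombi and its mid-edges)] -/
theorem exists_door_of_enter_pocket {P : Set Face} {a b : ℕ} (hab : a < b) (ha : ω.2.fc a ∉ P) (hb : ω.2.fc b ∈ P) :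
    ∃ t, a < t ∧ t ≤ b ∧ ω.2.fc (t - 1) ∉ P ∧ ω.2.fc t ∈ P := by
  obtain ⟨t, h1, h2, h3, h4⟩ := exists_door_of_exit_pocket (ω := ω) (P := Pᶜ) hab (show ω.2.fc a ∈ Pᶜ from ha)
    (show ω.2.fc b ∉ Pᶜ from fun h => h hb)
  exact ⟨t, h1, h2, h3, not_not.1 h4⟩

/-- A face of a mid-edge given by a side equation. [cite: GlazmanManolescu2019, §1 (the lattice of rhombi and its mid-edges)] -/
private theorem eq_faces_of_side_eqPK {F : Face} {x : Side} {e : MidEdge} (hx : F.side x = e) : F = e.faces.1 ∨ F = e.faces.2 :=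
  (Face.exists_side_eq_iff F e).1 ⟨x, hx⟩

/-! ## §1 The pocket law -/

/-- ★★★★★ **THE POCKET LAW** (`AJ` form). Hole absent; a lattice cut `q 0 = (w.1, w.2), …, q K` ending beyond the domain, edges neither the
hole's `W` side nor the root edge, all dead except `i < k`; a set of cells `P` with `w ∉ P`, `farW w ∉ P`, a face of the `i`-th edge in
`P`, and every live door of `P` (a common side of a cell of `P ∩ D` and a cell of `D ∖ P`) equal to the `i`-th or the `k`-th edge. Then
the excursion polygon of every class-`B2a` UNDER-walk at the far cell does not wind around the root.
[cite: GlazmanManolescu2019, Lemma 2.1 (statement, "in the form given in [Gl]"), §1 (Fig. 1–2)]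
[cite: Glazman2015WeightedSAW, Lemma 3.1 (proof, pp. 6–7: the classes of walks through a rhombus)]
[cite: CourantRobbins1958, Ch. V Appendix §2 (the even–odd rule)] -/
theorem AJ_root_eq_zero_of_twoLive_cut_pocket (hh : holeFaceW w ∉ D) {q : ℕ → ℤ × ℤ} {c : ℕ → Face} {s : ℕ → Side}
    {K : ℕ} (hq0 : q 0 = w)
    (hseg : ∀ k, k < K → segment ℝ (toC (cornerPt (q k))) (toC (cornerPt (q (k + 1)))) = sideSeg (c k) (s k))
    (h1 : ∀ k, k < K → (c k).side (s k) ≠ (holeFaceW w).side .W) (h2 : ∀ k, k < K → (c k).side (s k) ≠ w.side .W)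
    (hexit : (∀ f : Face, f ∈ D → f.1 < (q K).1) ∨ (∀ f : Face, f ∈ D → (q K).1 ≤ f.1) ∨
      (∀ f : Face, f ∈ D → (q K).2 ≤ f.2) ∨ (∀ f : Face, f ∈ D → f.2 < (q K).2))
    {i k : ℕ} (hik : i < k)
    (hdead : ∀ k', k' < K → k' ≠ i → k' ≠ k →
      ((c k').side (s k')).faces.1 ∉ D ∨ ((c k').side (s k')).faces.2 ∉ D)
    {P : Set Face} (hwP : w ∉ P) (hfP : farW w ∉ P)
    (hiP : ((c i).side (s i)).faces.1 ∈ P ∨ ((c i).side (s i)).faces.2 ∈ P)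
    (hdoor : ∀ g g' : Face, g ∈ P → g' ∉ P → g ∈ D → g' ∈ D → ∀ x x' : Side, g.side x = g'.side x' →
      g.side x = (c i).side (s i) ∨ g.side x = (c k).side (s k))
    (ω : ΩG D (w.side .W) (farW w)) (hr : RootedFace D (w.side .W) (farW w)) (h : ω.IsB2a)
    (hS : ω.2.firstSideG = .S) : ω.AJ hr h (toC (midPt (w.side .W))) = 0 := by
  by_contra hA
  have hF := ω.fh_lt h
  obtain ⟨⟨i', hi1, hiF, e⟩, hJ⟩ := prefix_and_exit_of_twoLive_cut hh hr h hS hq0 hseg h1 h2 hexit hik hdead hA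
  have hpre := prefix_nth_ne_of_exit hr h hJ
  -- the root cell and the far cell are outside the pocket
  have h0 : ω.2.fc 0 ∉ P := by rw [fc_zero_eq_root (w := w) hh ω.2 (by omega)]; exact hwP
  have hfh : ω.2.fc ω.2.firstHitG ∉ P := by rw [(fc_fh ω hr h).1]; exact hfP
  -- the cells around the prefix crossing of `eᵢ` are its two faces, one of them in `P`
  obtain ⟨⟨x₁, hx₁⟩, ⟨x₂, hx₂⟩, hne, -, -⟩ := fc_mem_faces_of_nth (ω := ω) hi1 (by omega)
  rw [e] at hx₁ hx₂
  have hin : ω.2.fc (i' - 1) ∈ P ∨ ω.2.fc i' ∈ P := by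
    rcases eq_faces_of_side_eqPK hx₁ with ea | ea <;> rcases eq_faces_of_side_eqPK hx₂ with eb | eb
    · exact absurd (ea.trans eb.symm) hne
    · rcases hiP with hp | hp
      · exact Or.inl (ea ▸ hp)
      · exact Or.inr (eb ▸ hp)
    · rcases hiP with hp | hp
      · exact Or.inr (eb ▸ hp)
      · exact Or.inl (ea ▸ hp)
    · exact absurd (ea.trans eb.symm) hne
  -- a door of `P` crossed by the prefix at index `t ≠ i'` is impossible
  have hcross : ∀ t, 1 ≤ t → t ≤ ω.2.firstHitG → t ≠ i' →
      ¬((ω.2.fc (t - 1) ∈ P ∧ ω.2.fc t ∉ P) ∨ (ω.2.fc (t - 1) ∉ P ∧ ω.2.fc t ∈ P)) := by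
    intro t ht1 htF hti hP
    obtain ⟨⟨y₁, hy₁⟩, ⟨y₂, hy₂⟩, -, hD₁, hD₂⟩ := fc_mem_faces_of_nth (ω := ω) ht1 (by omega)
    have hnth : ω.2.nth t = (c i).side (s i) ∨ ω.2.nth t = (c k).side (s k) := by
      rcases hP with ⟨hp, hq⟩ | ⟨hp, hq⟩
      · have := hdoor _ _ hp hq hD₁ hD₂ y₁ y₂ (hy₁.trans hy₂.symm); rwa [hy₁] at this
      · have := hdoor _ _ hq hp hD₂ hD₁ y₂ y₁ (hy₂.trans hy₁.symm); rwa [hy₂] at this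
    rcases hnth with hn | hn
    · rw [← e] at hn
      exact hti (YBWalk.nth_inj_of_le ω.2 (by omega) (by omega) hn)
    · exact hpre t ht1 htF hn
  rcases hin with hp | hp
  · -- inside `P` before the crossing: the prefix entered `P` at some door `t ≤ i' − 1`
    have hi2 : 2 ≤ i' := by
      by_contra hlt
      have : i' = 1 := by omega
      subst this
      exact h0 hp
    obtain ⟨t, ht0, hti, hq, hp'⟩ := exists_door_of_enter_pocket (ω := ω) (a := 0) (b := i' - 1) (by omega) h0 hp
    exact hcross t (by omega) (by omega) (by omega) (Or.inr ⟨hq, hp'⟩)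
  · -- inside `P` after the crossing: the prefix leaves `P` at some door `t > i'`
    have hiF' : i' < ω.2.firstHitG := lt_of_le_of_ne hiF fun e' => hfh (e' ▸ hp)
    obtain ⟨t, hti, htF, hp', hq⟩ := exists_door_of_exit_pocket (ω := ω) hiF' hp hfh
    exact hcross t (by omega) htF (by omega) (Or.inl ⟨hp', hq⟩)

/-- ★★★★★ **THE POCKET LAW, winding form**: under the hypotheses of `AJ_root_eq_zero_of_twoLive_cut_pocket`, every class-`B2a`
UNDER-walk at the far cell has its Yang–Baxter winding equal to the excursion winding (either orientation of the witness).
[cite: GlazmanManolescu2019, Lemma 2.1 (statement, "in the form given in [Gl]"), §1 (Fig. 2)]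
[cite: Glazman2015WeightedSAW, Lemma 3.1 (proof, pp. 6–7)] [cite: CourantRobbins1958, Ch. V Appendix §2 (the even–odd rule)] -/
theorem WE_eq_excursionWinding_of_under_twoLive_cut_pocket (hh : holeFaceW w ∉ D) {q : ℕ → ℤ × ℤ} {c : ℕ → Face}
    {s : ℕ → Side} {K : ℕ} (hq0 : q 0 = w)
    (hseg : ∀ k, k < K → segment ℝ (toC (cornerPt (q k))) (toC (cornerPt (q (k + 1)))) = sideSeg (c k) (s k))
    (h1 : ∀ k, k < K → (c k).side (s k) ≠ (holeFaceW w).side .W) (h2 : ∀ k, k < K → (c k).side (s k) ≠ w.side .W)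
    (hexit : (∀ f : Face, f ∈ D → f.1 < (q K).1) ∨ (∀ f : Face, f ∈ D → (q K).1 ≤ f.1) ∨
      (∀ f : Face, f ∈ D → (q K).2 ≤ f.2) ∨ (∀ f : Face, f ∈ D → f.2 < (q K).2))
    {i k : ℕ} (hik : i < k)
    (hdead : ∀ k', k' < K → k' ≠ i → k' ≠ k →
      ((c k').side (s k')).faces.1 ∉ D ∨ ((c k').side (s k')).faces.2 ∉ D)
    {P : Set Face} (hwP : w ∉ P) (hfP : farW w ∉ P)
    (hiP : ((c i).side (s i)).faces.1 ∈ P ∨ ((c i).side (s i)).faces.2 ∈ P)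
    (hdoor : ∀ g g' : Face, g ∈ P → g' ∉ P → g ∈ D → g' ∈ D → ∀ x x' : Side, g.side x = g'.side x' →
      g.side x = (c i).side (s i) ∨ g.side x = (c k).side (s k))
    (ω : ΩG D (w.side .W) (farW w)) (hr : RootedFace D (w.side .W) (farW w)) (h : ω.IsB2a)
    (hS : ω.2.firstSideG = .S) (θ : ℝ) :
    ω.WE (fun _ => θ) = excursionWinding θ ω.2.firstSideG (ω.z1 hr h) ω.1 := by
  by_contra hW
  rcases ω.AJ_ne_zero_or_rev_of_wound hr h θ hW with hA | hA
  · exact hA (AJ_root_eq_zero_of_twoLive_cut_pocket hh hq0 hseg h1 h2 hexit hik hdead hwP hfP hiP hdoor ω hr h hS)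
  · have h' := ω.rev_isB2a hr h
    have hS' : (ω.rev hr).2.firstSideG = .S := by rw [ω.rev_firstSide hr h]; exact hS
    exact hA (AJ_root_eq_zero_of_twoLive_cut_pocket hh hq0 hseg h1 h2 hexit hik hdead hwP hfP hiP hdoor (ω.rev hr) hr h' hS')

end ΩG

end Literature.Probability.RandomPlanarGeometry.SAW.YangBaxter
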